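import Summits.Ventures.PercRepro.S1SpreadSlackZeroBase
import Mathlib.Data.Set.Card.Arithmetic

/-!
# PercRepro — WHEN THE TRIANGLES EXHAUST THE NULLITY OF A COLOOP-FREE SPREAD CORE, EVERY POINT LIES ON A TRIANGLE: `n ≤ 3d`
(p1, gen 36)

`proofs/P1-S2-CORANK6.md` §4u. On a spread e-free core of nullity `d ≥ 5` with `d` triangles, the union `U` of the triangles
already has nullity `≥ d` (private points raise the nullity, `eRk_add_card_le_ncard_biUnion`), hence exactly `d`: a point `e`
outside `U` would be a coloop (`rank E = rank U + |E ∖ U|`, so `rank (E ∖ e) < rank E`). So on a coloop-free core `E = U`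
(**`ground_subset_biUnion_of_triangles_eq_nullity`**) and `|E| ≤ 3d` (**`ncard_ground_le_three_mul_of_triangles_eq_nullity`**):
the row `t = d` of the spread case is EMPTY on every cell `(p, d)` with `p + d > 3d`, e.g. `(13, 6)` (`19 > 18`).
Nothing about any cell is claimed. Axioms: standard.
-/

open scoped Matroid

namespace PercRepro

namespace S1

open Set

variable {α : Type}

/-- **Every point of a coloop-free spread e-free core with `d ≥ 5` triangles at nullity `d` lies on a triangle.** -/
theorem ground_subset_biUnion_of_triangles_eq_nullity (M : Matroid α) [M.Finite]
    (hfree : ∀ e ∈ M.E, ∃ A ⊆ M.E \ {e}, e ∉ M.closure A ∧ e ∉ M.closure ((M.E \ {e}) \ A))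
    (hns : ¬ ∃ W ⊆ M.E, W.ncard ≤ 9 ∧ W.encard = M.eRk W + 4) {d : ℕ} (hd : M.E.encard = M.eRank + d)
    (h5 : 5 ≤ d) (ht : {C : Set α | M.IsCircuit C ∧ C.ncard = 3}.ncard = d) (hK : ∀ e, ¬ M.IsColoop e) :
    M.E ⊆ ⋃ T ∈ {C : Set α | M.IsCircuit C ∧ C.ncard = 3}, T := by
  classical
  have hno := no_six_of_five_le_triangles M hfree hns (by omega)
  set 𝒯s := {C : Set α | M.IsCircuit C ∧ C.ncard = 3} with h𝒯s
  have h𝒯fin : 𝒯s.Finite := M.ground_finite.finite_subsets.subset (fun C hC => hC.1.subset_ground)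
  have hS : ∀ T ∈ h𝒯fin.toFinset, M.IsCircuit T := fun T hT => ((Finite.mem_toFinset h𝒯fin).1 hT).1
  have hpriv : ∀ T ∈ h𝒯fin.toFinset, ∃ p ∈ T, ∀ T' ∈ h𝒯fin.toFinset, T' ≠ T → p ∉ T' := by
    intro T hT
    rw [Finite.mem_toFinset] at hT
    obtain ⟨p, hp, hp'⟩ := exists_private_of_no_six M hfree hns hno hT.1 hT.2
    exact ⟨p, hp, fun T' hT' hne => hp' T' ((Finite.mem_toFinset h𝒯fin).1 hT').1 ((Finite.mem_toFinset h𝒯fin).1 hT').2 hne⟩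
  obtain ⟨r, hr, hle⟩ := eRk_add_card_le_ncard_biUnion M h𝒯fin.toFinset hS hpriv
  set U := ⋃ T ∈ h𝒯fin.toFinset, T with hU
  have hUE : U ⊆ M.E := by
    intro t ht
    simp only [hU, mem_iUnion, exists_prop] at ht
    obtain ⟨T, hT, ht⟩ := ht
    exact (hS T hT).subset_ground ht
  have hUeq : (⋃ T ∈ 𝒯s, T) = U := by
    rw [hU]; ext t
    simp only [mem_iUnion, exists_prop, Finite.mem_toFinset]
  rw [hUeq]
  have hcard : h𝒯fin.toFinset.card = d := by rw [← Set.ncard_eq_toFinset_card 𝒯s h𝒯fin]; exact ht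
  rw [hcard] at hle
  have hrU : (M.eRk U).toNat = r := by rw [hr]; rfl
  -- the nullity of `U` is exactly `d`, so `rank E = rank U + |E ∖ U|`
  have hbud := ncard_le_eRk_toNat_add_of_subset M hd hUE
  rw [hrU] at hbud
  have hEfin : M.E.Finite := M.ground_finite
  have hUfin : U.Finite := hEfin.subset hUE
  have hEcard : M.E.ncard = U.ncard + (M.E \ U).ncard := by
    rw [← Set.ncard_union_eq disjoint_sdiff_right hUfin (hEfin.subset sdiff_subset), union_sdiff_cancel hUE]
  have hEd : M.E.ncard = (M.eRk M.E).toNat + d := by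
    have h := hd
    rw [Matroid.eRank_def, ← coe_toNat_eRk M (subset_refl _), ← hEfin.cast_ncard_eq] at h
    exact_mod_cast h
  intro e heE
  by_contra heU
  -- `rank (E ∖ e) ≤ rank U + |E ∖ U| − 1 < rank E`, but `e` is not a coloop
  have hcl : e ∈ M.closure (M.E \ {e}) := by
    by_contra h
    exact hK e ((Matroid.isColoop_iff_notMem_closure_compl heE).2 h)
  have hEe : M.eRk M.E = M.eRk (M.E \ {e}) := by
    have : M.E = (M.E \ {e}) ∪ {e} := by
      ext u; simp only [mem_union, mem_sdiff, mem_singleton_iff]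
      constructor
      · intro hu; by_cases hue : u = e; exact Or.inr hue; exact Or.inl ⟨hu, hue⟩
      · rintro (hu | rfl); exact hu.1; exact heE
    conv_lhs => rw [this]
    exact eRk_union_eq_of_subset_closure M (by simpa using hcl)
  have hsub : M.E \ {e} ⊆ U ∪ ((M.E \ U) \ {e}) := by
    intro u hu
    by_cases huU : u ∈ U
    · exact Or.inl huU
    · exact Or.inr ⟨⟨hu.1, huU⟩, hu.2⟩
  have h1 : M.eRk (M.E \ {e}) ≤ M.eRk U + ((M.E \ U) \ {e}).encard :=
    (M.eRk_mono hsub).trans (M.eRk_union_le_eRk_add_encard _ _)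
  have h2 : ((M.E \ U) \ {e}).ncard + 1 = (M.E \ U).ncard :=
    Set.ncard_sdiff_singleton_add_one (s := M.E \ U) (⟨heE, heU⟩ : e ∈ M.E \ U) (hEfin.subset sdiff_subset)
  rw [← hEe, ← coe_toNat_eRk M (subset_refl _), ← coe_toNat_eRk M hUE, hrU,
    ← ((hEfin.subset sdiff_subset).subset sdiff_subset).cast_ncard_eq] at h1
  have h1' : (M.eRk M.E).toNat ≤ r + ((M.E \ U) \ {e}).ncard := by exact_mod_cast h1
  omega

/-- **`|E| ≤ 3d`** on a coloop-free spread e-free core with `d ≥ 5` triangles at nullity `d`: the row `t = d` of the spread case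
is empty whenever `n > 3d`. -/
theorem ncard_ground_le_three_mul_of_triangles_eq_nullity (M : Matroid α) [M.Finite]
    (hfree : ∀ e ∈ M.E, ∃ A ⊆ M.E \ {e}, e ∉ M.closure A ∧ e ∉ M.closure ((M.E \ {e}) \ A))
    (hns : ¬ ∃ W ⊆ M.E, W.ncard ≤ 9 ∧ W.encard = M.eRk W + 4) {d : ℕ} (hd : M.E.encard = M.eRank + d)
    (h5 : 5 ≤ d) (ht : {C : Set α | M.IsCircuit C ∧ C.ncard = 3}.ncard = d) (hK : ∀ e, ¬ M.IsColoop e) :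
    M.E.ncard ≤ 3 * d := by
  classical
  have hsub := ground_subset_biUnion_of_triangles_eq_nullity M hfree hns hd h5 ht hK
  set 𝒯s := {C : Set α | M.IsCircuit C ∧ C.ncard = 3} with h𝒯s
  have h𝒯fin : 𝒯s.Finite := M.ground_finite.finite_subsets.subset (fun C hC => hC.1.subset_ground)
  have hUeq : (⋃ T ∈ 𝒯s, T) = ⋃ T ∈ h𝒯fin.toFinset, T := by
    ext t; simp only [mem_iUnion, exists_prop, Finite.mem_toFinset]
  rw [hUeq] at hsub
  have hcard : h𝒯fin.toFinset.card = d := by rw [← Set.ncard_eq_toFinset_card 𝒯s h𝒯fin]; exact ht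
  have hUfin : (⋃ T ∈ h𝒯fin.toFinset, T).Finite :=
    Set.Finite.biUnion (Finset.finite_toSet _) (fun T hT => M.ground_finite.subset
      ((Finite.mem_toFinset h𝒯fin).1 hT).1.subset_ground)
  calc M.E.ncard ≤ (⋃ T ∈ h𝒯fin.toFinset, T).ncard := Set.ncard_le_ncard hsub hUfin
    _ ≤ ∑ T ∈ h𝒯fin.toFinset, T.ncard := Finset.set_ncard_biUnion_le _ _
    _ = ∑ T ∈ h𝒯fin.toFinset, 3 := Finset.sum_congr rfl (fun T hT => ((Finite.mem_toFinset h𝒯fin).1 hT).2)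
    _ = 3 * d := by rw [Finset.sum_const, smul_eq_mul, hcard, mul_comm]

end S1

end PercRepro
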